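import Literature.Computability.AlgebraicComplexity.BorderRankCWKoszul
import HarnessLib

/-!
# CGLV 2022, Cor. 3.5 (`CGLV2022_cor35`): proofs file

Topic: `Literature/Computability/AlgebraicComplexity`. Sibling proofs file of `BorderRankCWKoszul.lean`
(named facts `CGLV2022_thm33_koszulRank_q4`, `CGLV2022_thm34_koszulRank`, `CGLV2022_cor35` of
Conner–Gesmundo–Landsberg–Ventura, *Rank and border rank of Kronecker powers of tensors and Strassen's
laser method*, comput. complexity 31 (2022) = arXiv:1909.04785v2: Thm. 3.3 (proof, `q = 4`), Thm. 3.4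
(proof), Cor. 3.5), for the fact item `provefact … CGLV2022_cor35`.  Everything here is PROVED; there
are no definitions and no named facts.

## Content

* `rank_koszulFlattening_cglvPhi3_le`, `rank_koszulFlattening_cglvPhi2_four_le` — the flattening ranks
  are AT MOST what the facts claim (`6(q+2)³`, resp. `72`): Koszul bound `rank K_M(t) ≤ C(2p,p) · bR(t)`
  (`KoszulFlatteningBorderRank.lean`) and `bR(T_{cw,q}^{⊠N}) ≤ (q+2)^N` (`BorderRankCWKoszulRanks.lean`).
* `CGLV2022_thm33_koszulRank_q4_iff_ge`, `CGLV2022_thm34_koszulRank_iff_ge` — hence both rank facts are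
  equivalent to LOWER bounds, i.e. to rank certificates (non-zero minors).
* `CGLV2022_cor35_of_koszulRank_ge` — Cor. 3.5 from the two lower bounds; `CGLV2022_cor35_four_of_koszulRank_ge`
  (the clause `q = 4`) and `CGLV2022_cor35_at_of_koszulRank_ge` (the clause `q > 4`, one `q` at a time,
  as in the printed proof: Prop. 3.2 with `T₁ = T_{cw,q}^{⊠3}`, `T₂ = T_{cw,q}^{⊠(N-3)}` `1_A`-generic).

The discharge `CGLV2022_cor35_holds` waits on the two certificates (Thm. 3.3 at `q = 4`: one `75 × 75`
integer matrix of rank `72`; Thm. 3.4: `rank = 6(q+2)³` for all `q ≥ 5`, which the source proves by an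
`𝔖_{q-4}^{×3}`-isotypic block decomposition with blocks of sizes `2160, 360, 60, 10` and ranks
`2058, 294, 42, 6`, their entries polynomial in `q`, certified by computer algebra — proof of Thm. 3.4
and §7 of arXiv v2).

## References

* A. Conner, F. Gesmundo, J. M. Landsberg, E. Ventura, *Rank and border rank of Kronecker powers of
  tensors and Strassen's laser method*, comput. complexity 31 (2022), §3 eq. (8), Prop. 3.2, Thm. 3.3,
  Thm. 3.4, Cor. 3.5 (arXiv:1909.04785: Prop. 4.1, Thms. 2.1–2.2, Cor. 2.3, §§4.5–4.6, §7),
  doi:10.1007/s00037-021-00217-y. [ConnerGesmundoLandsbergVentura2022]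
-/

noncomputable section

open scoped BigOperators
open Module

namespace Literature.Computability.AlgebraicComplexity

/-! ## The rank facts are lower bounds: the matching upper bounds are free

The two rank facts of `BorderRankCWKoszul.lean` assert equalities, but only the inequalities `72 ≤ rank` and
`6(q+2)³ ≤ rank` carry content: the reverse inequalities follow from the Koszul bound
`rank K_M(t) ≤ C(2p,p) · bR(t)` (`KoszulFlatteningBorderRank.lean`) and the submultiplicative upper
bound `bR(T_{cw,q}^{⊠N}) ≤ (q+2)^N` (`BorderRankCWKoszulRanks.lean`).  So a discharge of either fact,
and of Cor. 3.5, needs only a LOWER-bound certificate for the flattening rank (a non-zero minor). -/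

section LowerBounds

/-- `rank((φ₃ T_{cw,q}^{⊠3})^{∧2}_{A'}) ≤ 6 (q+2)³` for every `q`: the Koszul bound
`rank ≤ C(4,2) · bR(T_{cw,q}^{⊠3})` and `bR(T_{cw,q}^{⊠3}) ≤ (q+2)³` (CGLV: "which implies
`bR(T_{cw,q}^{⊠3}) ≥ (q+2)³`", read backwards). [cite: ConnerGesmundoLandsbergVentura2022, Thm. 3.4 (proof)] -/
theorem rank_koszulFlattening_cglvPhi3_le (q : ℕ) :
    (koszulFlattening 2 (cglvPhi3 ℂ q).mulVecLin (kroneckerPow (cwTensor ℂ q) 3)).rank ≤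
      6 * (q + 2) ^ 3 := by
  have h := rank_koszulFlattening_le_choose_mul_algBorderRank 2 (cglvPhi3 ℂ q)
    (kroneckerPow (cwTensor ℂ q) 3)
  rw [show Nat.choose (2 * 2) 2 = 6 by decide] at h
  exact h.trans (Nat.mul_le_mul_left 6 (algBorderRank_kroneckerPow_cwTensor_le ℂ q 3))

/-- `rank((φ₂ T_{cw,4}^{⊠2})^{∧1}_{A'}) ≤ 72 = 2 · (4+2)²`: the Koszul bound `rank ≤ C(2,1) · bR` and
`bR(T_{cw,4}^{⊠2}) ≤ 36`. [cite: ConnerGesmundoLandsbergVentura2022, Thm. 3.3 (proof, case q = 4)] -/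
theorem rank_koszulFlattening_cglvPhi2_four_le :
    (koszulFlattening 1 (cglvPhi2 ℂ 4).mulVecLin (kroneckerPow (cwTensor ℂ 4) 2)).rank ≤ 72 := by
  have h := rank_koszulFlattening_le_choose_mul_algBorderRank 1 (cglvPhi2 ℂ 4)
    (kroneckerPow (cwTensor ℂ 4) 2)
  rw [show Nat.choose (2 * 1) 1 = 2 by decide] at h
  have h' : 2 * algBorderRank (kroneckerPow (cwTensor ℂ 4) 2) ≤ 72 :=
    (Nat.mul_le_mul_left 2 (algBorderRank_kroneckerPow_cwTensor_le ℂ 4 2)).trans (by norm_num)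
  exact h.trans h'

/-- The base case `q = 4` of Thm. 3.3 is equivalent to the lower bound `72 ≤ rank`.
[cite: ConnerGesmundoLandsbergVentura2022, Thm. 3.3 (proof, case q = 4)] -/
theorem CGLV2022_thm33_koszulRank_q4_iff_ge :
    CGLV2022_thm33_koszulRank_q4 ↔
      72 ≤ (koszulFlattening 1 (cglvPhi2 ℂ 4).mulVecLin (kroneckerPow (cwTensor ℂ 4) 2)).rank :=
  ⟨fun h => h.ge, fun h => le_antisymm rank_koszulFlattening_cglvPhi2_four_le h⟩

/-- The rank computation of Thm. 3.4 is equivalent to the lower bounds `6(q+2)³ ≤ rank` (`q ≥ 5`).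
[cite: ConnerGesmundoLandsbergVentura2022, Thm. 3.4 (proof)] -/
theorem CGLV2022_thm34_koszulRank_iff_ge :
    CGLV2022_thm34_koszulRank ↔ ∀ q : ℕ, 5 ≤ q →
      6 * (q + 2) ^ 3 ≤
        (koszulFlattening 2 (cglvPhi3 ℂ q).mulVecLin (kroneckerPow (cwTensor ℂ q) 3)).rank :=
  ⟨fun h q hq => (h q hq).ge,
    fun h q hq => le_antisymm (rank_koszulFlattening_cglvPhi3_le q) (h q hq)⟩

/-- **Cor. 3.5 from the two lower bounds alone** (`72 ≤ rank` of the square flattening at `q = 4`,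
`6(q+2)³ ≤ rank` of the cube flattenings for `q ≥ 5`), i.e. from rank certificates.
[cite: ConnerGesmundoLandsbergVentura2022, Cor. 3.5 (proof)] -/
theorem CGLV2022_cor35_of_koszulRank_ge
    (h4 : 72 ≤ (koszulFlattening 1 (cglvPhi2 ℂ 4).mulVecLin (kroneckerPow (cwTensor ℂ 4) 2)).rank)
    (h34 : ∀ q : ℕ, 5 ≤ q →
      6 * (q + 2) ^ 3 ≤
        (koszulFlattening 2 (cglvPhi3 ℂ q).mulVecLin (kroneckerPow (cwTensor ℂ q) 3)).rank) :
    CGLV2022_cor35 :=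
  CGLV2022_cor35_of_koszulRank (CGLV2022_thm33_koszulRank_q4_iff_ge.2 h4)
    (CGLV2022_thm34_koszulRank_iff_ge.2 h34)

/-- The second clause of Cor. 3.5 (`q = 4`, all `N ≥ 2`) from the single lower bound `72 ≤ rank`.
[cite: ConnerGesmundoLandsbergVentura2022, Cor. 3.5 (proof)] -/
theorem CGLV2022_cor35_four_of_koszulRank_ge
    (h4 : 72 ≤ (koszulFlattening 1 (cglvPhi2 ℂ 4).mulVecLin (kroneckerPow (cwTensor ℂ 4) 2)).rank)
    (N : ℕ) (hN : 2 ≤ N) : 36 * 5 ^ (N - 2) ≤ algBorderRank (kroneckerPow (cwTensor ℂ 4) N) :=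
  CGLV2022_thm12_power_four_of_koszulRank (CGLV2022_thm33_koszulRank_q4_iff_ge.2 h4) N hN

/-- The first clause of Cor. 3.5 at a single `q ≥ 5` (all `N ≥ 3`) from the single lower bound
`6(q+2)³ ≤ rank` at that `q` (the proof of Cor. 3.5 is `q`-by-`q`). [cite: ConnerGesmundoLandsbergVentura2022, Cor. 3.5 (proof)] -/
theorem CGLV2022_cor35_at_of_koszulRank_ge {q : ℕ} (hq : 4 < q)
    (h : 6 * (q + 2) ^ 3 ≤
      (koszulFlattening 2 (cglvPhi3 ℂ q).mulVecLin (kroneckerPow (cwTensor ℂ q) 3)).rank)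
    (N : ℕ) (hN : 3 ≤ N) :
    (q + 1) ^ (N - 3) * (q + 2) ^ 3 ≤ algBorderRank (kroneckerPow (cwTensor ℂ q) N) := by
  have hα := isUnit_contractFirst_cwCovector (K := ℂ) (q := q) (by omega)
  have key := rank_koszulFlattening_mul_pow_le_algBorderRank_kroneckerPow (cwTensor ℂ q) hα 2 3
    (N - 3) N (by omega) (cglvPhi3 ℂ q).mulVecLin
  rw [Fintype.card_fin, show Nat.choose (2 * 2) 2 = 6 by decide] at key
  have key' := (Nat.mul_le_mul_right ((q + 1) ^ (N - 3)) h).trans key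
  have e : 6 * ((q + 1) ^ (N - 3) * (q + 2) ^ 3) = 6 * (q + 2) ^ 3 * (q + 1) ^ (N - 3) := by ring
  exact Nat.le_of_mul_le_mul_left (e ▸ key') (by norm_num)

end LowerBounds

end Literature.Computability.AlgebraicComplexity

end
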